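import Summits.QuantumAdvantage.AdviceFreeQNC0.MassInequalityK
import Summits.QuantumAdvantage.AdviceFreeQNC0.TensorLPInduction
import Summits.QuantumAdvantage.AdviceFreeQNC0.TensorLPCertificates
import HarnessLib

/-!
# Cell qa-qnc0 (rung F-Q1, density axis, crux of record `TensorMultOneAt` = MULT₁): THE RECURSION —
# `MassIneqKPays m` for every `m` (planner qa-qnc0-p1 Sketch13 v6b, ask P18″), and `ExactMultSeven`

Planner qa-qnc0-p1 gen 13 (`HOME/qa-qnc0-p1/ROUND-12.md` §2.10 (xi-h)…(xi-q), Sketch13 v6b/v6e; statements in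
`MassInequalityK.lean`): the MASS INEQUALITY `MassIneqK m k K0` at an optimal one-block codeword `K0`
(failure set `Z = {K0 = 0}`, `|Z| = failCount K0`) for all levels `k` pays tensor multiplicativity with
ratio `failCount K0 / 2^m` at every tower level — "exact accounting at level `k+1` + induction".

THE ACCOUNTING (proved here, `MIPays.step`).  Cut `{0,1}^{m(k+1)}` along the last block (content `u`,
context `v ∈ {0,1}^{mk}`).  An element of the `(k+1)`-block sum code is `win(v ++ u) = W'_u(v) ⊕ P_v(u)`
with every `W'_u` in the `k`-block sum code `S_k` (`TensorLP.isBlockElim_slice`) and every COLUMN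
`P_v = X_k(v ++ ·)` a one-block codeword (`IsElim1`, the last even triple is affine in the last block's
bits).  Put `D u v := P_v(u) ⊕ K0(u)` — a deviation with codeword columns (`ColsInCK`).  The fibre over
`u` fails on `pdist(¬P_·(u), W'_u) ≥ d(¬row_u, S_k)` contexts; for `u ∈ Z` the row is `𝟙 ⊕ D u`, so
`d ≥ d(𝟙, S_k) − d(D u, S_k)` (subadditivity, `distTo_xor_le`), for `u ∉ Z` it is `D u` itself.  Summing,
`#FAIL(win) ≥ |Z|·d(𝟙,S_k) + bracketK m k K0 D ≥ |Z|·W_k` by `MassIneqK`, and `d(𝟙, S_k) = min_{S_k} #FAIL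
≥ |Z|^k` by induction.  Level `0 → 1` uses `MassIneqK m 0 K0`, which IS support concentration SC₁
(`massIneqK_zero`, from qn-lit's `sc1At_of_isOpt1`).

* **`massIneqKPays : ∀ m, MassIneqKPays m`** (Sketch13 v6b statement, `MassInequalityK.lean`);
* `massIneqK_zero : IsOpt1 m K0 → MassIneqK m 0 K0` (MI at level one = SC₁);
* `tensorMultAt_of_massIneq : IsOpt1 m K0 → (∀ k, 0 < k → MassIneqK m k K0) → TensorMultAt m 1 (failCount K0 / 2^m)`;
* **`exactMultSeven : ExactMultSeven`** (`TensorMultAt 7 1 (16/2^7)`) — from the kernel-checked LP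
  certificate `tensorMultAt_seven` (`TensorLPCertificates.lean`; `16/2^7 = 1/8`); the MI route
  `exactMultSeven_of` needs only `DomSeven` besides `domPays 7` and `massIneqKPays 7`.

Hence `MIChainFifteen` has ONE open hypothesis left in the kernel: `MassIneqAll 15` (plus the finite
existence conjunct).  The cell's theorems (not in print).  WHAT THIS IS NOT: the mass inequality itself
(`MassIneqAll m`, the far regime) is OPEN; nothing on α; separation NOT moved.
-/

noncomputable section

namespace Summit.QuantumAdvantage.AdviceFreeQNC0

open Finset
open Literature.Computability.MetaComplexity Literature.Computability.MetaComplexity.Smolensky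
open MassInequality TensorLP

namespace MIPays

variable {n : ℕ}

/-- `pdist 𝟙 Q = failCount Q`. -/
theorem pdist_true (Q : (Fin n → Bool) → Bool) : pdist (fun _ => true) Q = failCount Q := by
  unfold pdist failCount
  congr 1; ext v
  simp only [mem_filter, mem_univ, true_and]
  cases Q v <;> simp

/-- The `0`-block sum code is `{0}`: its elements vanish identically. -/
theorem eq_false_of_sumCodeWin_zero {m : ℕ} {Q : (Fin (m * 0) → Bool) → Bool}
    (hQ : SumCodeWin (m * 0) 0 1 Q) (v : Fin (m * 0) → Bool) : Q v = false := by
  obtain ⟨X, -, hQ⟩ := hQ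
  rw [hQ v]; simp

/-- Distance to the `0`-block sum code is the weight. -/
theorem distTo_zero_eq_pwt {m : ℕ} (r : (Fin (m * 0) → Bool) → Bool) :
    distTo (SumCodeWin (m * 0) 0 1) r = pwt r := by
  apply le_antisymm
  · rw [← pdist_false r]; exact distTo_le (sumCode_false m 0)
  · obtain ⟨Q, hQ, hQd⟩ := exists_eq_distTo ⟨_, sumCode_false m 0⟩ r
    have hQ0 : Q = fun _ => false := funext (eq_false_of_sumCodeWin_zero hQ)
    rw [← hQd, hQ0, pdist_false]

/-- On the one-point cube `{0,1}^{m·0}` the weight of `r` is `[r(pt)]`. -/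
theorem pwt_zero_cube {m : ℕ} (r : (Fin (m * 0) → Bool) → Bool) :
    pwt r = if r (fun i => i.elim0) = true then 1 else 0 := by
  unfold pwt
  have huniv : (univ : Finset (Fin (m * 0) → Bool)) = {fun i => i.elim0} := by
    apply eq_singleton_iff_unique_mem.2
    exact ⟨mem_univ _, fun x _ => funext fun i => i.elim0⟩
  rw [huniv, filter_singleton]
  split_ifs <;> simp

/-- **MI at level one is support concentration**: `IsOpt1 m K0 → MassIneqK m 0 K0`. -/
theorem massIneqK_zero {m : ℕ} {K0 : (Fin m → Bool) → Bool} (hK : IsOpt1 m K0) : MassIneqK m 0 K0 := by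
  intro D hD
  have hsc := sc1At_of_isOpt1 hK (fun u => D u fun i => i.elim0) (hD _)
  unfold bracketK
  simp only [distTo_zero_eq_pwt, pwt_zero_cube]
  push_cast
  rw [Finset.sum_ite, Finset.sum_ite]
  simp only [sum_const_zero, add_zero, sum_const, nsmul_eq_mul, mul_one, filter_filter]
  have e1 : (univ.filter fun u : Fin m → Bool => K0 u = true ∧ D u (fun i => i.elim0) = true) =
      univ.filter fun u : Fin m → Bool => D u (fun i => i.elim0) = true ∧ K0 u = true :=
    filter_congr fun u _ => and_comm
  have e2 : (univ.filter fun u : Fin m → Bool => K0 u = false ∧ D u (fun i => i.elim0) = true) =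
      univ.filter fun u : Fin m → Bool => D u (fun i => i.elim0) = true ∧ K0 u = false :=
    filter_congr fun u _ => and_comm
  rw [e1, e2]
  have := hsc
  omega

/-- **The accounting step**: `MassIneqK m k K0` and `W_k ≥ |Z|^k` give `W_{k+1} ≥ |Z|^{k+1}`. -/
theorem step {m k : ℕ} {K0 : (Fin m → Bool) → Bool} (hK : IsElim1 m K0) (hMI : MassIneqK m k K0)
    (IH : ∀ w : (Fin (m * k) → Bool) → Bool, SumCodeWin (m * k) k 1 w → failCount K0 ^ k ≤ failCount w)
    (win : (Fin (m * k + m) → Bool) → Bool) (hwin : SumCodeWin (m * k + m) (k + 1) 1 win) :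
    failCount K0 ^ (k + 1) ≤ failCount win := by
  classical
  obtain ⟨X, hX, hwinX⟩ := hwin
  obtain ⟨T, hTdeg, hTeven, hTX⟩ := hX k (Nat.lt_succ_self k)
  set S : ((Fin (m * k) → Bool) → Bool) → Prop := SumCodeWin (m * k) k 1 with hS
  have hS0 : S (fun _ => false) := sumCode_false m k
  have hSxor : ∀ Q Q', S Q → S Q' → S (fun v => xor (Q v) (Q' v)) :=
    fun Q Q' hQ hQ' => TensorLP.sumCodeWin_xor hQ hQ'
  -- the columns of the last triple are one-block codewords
  have hcol : ∀ v : Fin (m * k) → Bool, IsElim1 m (fun u => X k (Fin.append v u)) := by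
    intro v
    refine ⟨fun r u => T r (Fin.append v u), fun r => ?_, fun u => hTeven _, fun u => ?_⟩
    · have h2 := TensorLP.hasDeg_append_left (hTdeg r (Fin.append v fun _ => false)) v
      have heq : (fun u : Fin m → Bool =>
          T r (mergeBlock (m * k + m) (k + 1) k (Fin.append v fun _ => false) (Fin.append v u))) =
          fun u => T r (Fin.append v u) := funext fun u => by rw [TensorLP.mergeBlock_last]
      unfold HasDeg at h2 ⊢
      rw [heq] at h2
      exact h2
    · show X k (Fin.append v u) = T (wt u % 3) (Fin.append v u)
      rw [hTX, TensorLP.blockWt_append_last]; rfl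
  -- the deviation and the mass inequality
  set D : (Fin m → Bool) → (Fin (m * k) → Bool) → Bool :=
    fun u v => xor (X k (Fin.append v u)) (K0 u) with hD
  have hcols : ColsInCK m k D := fun v => isElim1_xor (hcol v) hK
  have hB : 0 ≤ bracketK m k K0 D := hMI D hcols
  -- the sliced sum-code parts
  have hW'S : ∀ u : Fin m → Bool,
      S (fun v => decide ((((range k).filter fun j => X j (Fin.append v u) = true)).card % 2 = 1)) :=
    fun u => ⟨fun j v => X j (Fin.append v u),
      fun j hj => TensorLP.isBlockElim_slice hj (hX j (hj.trans (Nat.lt_succ_self k))) u, fun v => rfl⟩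
  -- fibre failure counts are distances to the sliced parts
  have hfib : ∀ u : Fin m → Bool, failCount (fun v : Fin (m * k) → Bool => win (Fin.append v u)) =
      pdist (fun v => !(X k (Fin.append v u)))
        (fun v => decide ((((range k).filter fun j => X j (Fin.append v u) = true)).card % 2 = 1)) := by
    intro u
    unfold failCount pdist
    congr 1; ext v
    simp only [mem_filter, mem_univ, true_and]
    rw [hwinX, TensorLP.decide_range_succ]
    generalize decide ((((range k).filter fun j => X j (Fin.append v u) = true)).card % 2 = 1) = b
    cases b <;> cases X k (Fin.append v u) <;> decide
  have hlow : ∀ u : Fin m → Bool, (distTo S (fun v => !(X k (Fin.append v u))) : ℤ) ≤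
      failCount (fun v : Fin (m * k) → Bool => win (Fin.append v u)) := fun u => by
    rw [hfib]; exact_mod_cast distTo_le (hW'S u)
  -- rows inside `Z`: `¬P(u) = 𝟙 ⊕ D u`, so `d ≥ d(𝟙) − d(D u)`
  have hrow_in : ∀ u, K0 u = false →
      (distTo S (fun _ => true) : ℤ) - distTo S (D u) ≤ distTo S (fun v => !(X k (Fin.append v u))) := by
    intro u hu
    have e1 : (fun v : Fin (m * k) → Bool => !(X k (Fin.append v u))) = fun v => xor true (D u v) := by
      funext v; simp only [hD, hu, Bool.xor_false, Bool.true_xor]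
    have e2 : (fun _ : Fin (m * k) → Bool => true) = fun v => xor (xor true (D u v)) (D u v) := by
      funext v; cases D u v <;> rfl
    have h := distTo_xor_le ⟨_, hS0⟩ hSxor (fun v => xor true (D u v)) (D u)
    rw [← e2] at h
    rw [e1]
    omega
  -- rows outside `Z`: `¬P(u) = D u`
  have hrow_out : ∀ u, K0 u = true →
      (distTo S (fun v => !(X k (Fin.append v u))) : ℤ) = distTo S (D u) := by
    intro u hu
    have e1 : (fun v : Fin (m * k) → Bool => !(X k (Fin.append v u))) = D u := by
      funext v; simp only [hD, hu, Bool.xor_true]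
    rw [e1]
  -- `W_k = d(𝟙, S_k) ≥ |Z|^k`
  have hW : failCount K0 ^ k ≤ distTo S (fun _ => true) := by
    obtain ⟨Q, hQ, hQd⟩ := exists_eq_distTo ⟨_, hS0⟩ (fun _ : Fin (m * k) → Bool => true)
    rw [← hQd, pdist_true]; exact IH Q hQ
  -- assemble
  rw [TensorBlocksFixed.failCount_eq_sum_append (M := m * k) (r := m) win]
  have hsplit := sum_filter_add_sum_filter_not (univ : Finset (Fin m → Bool)) (fun u => K0 u = true)
    (fun u => (failCount (fun v : Fin (m * k) → Bool => win (Fin.append v u)) : ℤ))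
  have hnot : (univ.filter fun u : Fin m → Bool => ¬ K0 u = true) =
      univ.filter fun u : Fin m → Bool => K0 u = false :=
    filter_congr fun u _ => by cases K0 u <;> simp
  rw [hnot] at hsplit
  have hout : ∑ u ∈ univ.filter (fun u : Fin m → Bool => K0 u = true), (distTo S (D u) : ℤ) ≤
      ∑ u ∈ univ.filter (fun u : Fin m → Bool => K0 u = true),
        (failCount (fun v : Fin (m * k) → Bool => win (Fin.append v u)) : ℤ) :=
    sum_le_sum fun u hu => by rw [← hrow_out u (mem_filter.1 hu).2]; exact hlow u
  have hin : ∑ u ∈ univ.filter (fun u : Fin m → Bool => K0 u = false),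
        ((distTo S (fun _ => true) : ℤ) - distTo S (D u)) ≤
      ∑ u ∈ univ.filter (fun u : Fin m → Bool => K0 u = false),
        (failCount (fun v : Fin (m * k) → Bool => win (Fin.append v u)) : ℤ) :=
    sum_le_sum fun u hu => (hrow_in u (mem_filter.1 hu).2).trans (hlow u)
  rw [sum_sub_distrib, sum_const, nsmul_eq_mul] at hin
  have hZ : (univ.filter fun u : Fin m → Bool => K0 u = false).card = failCount K0 := rfl
  rw [hZ] at hin
  unfold bracketK at hB
  have hfinal : ((failCount K0 : ℕ) : ℤ) * (distTo S (fun _ => true) : ℤ) ≤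
      ∑ u, (failCount (fun v : Fin (m * k) → Bool => win (Fin.append v u)) : ℤ) := by
    rw [← hsplit]; linarith
  have hW' : ((failCount K0 ^ k : ℕ) : ℤ) ≤ (distTo S (fun _ => true) : ℤ) := by exact_mod_cast hW
  have h1 : ((failCount K0 ^ (k + 1) : ℕ) : ℤ) ≤
      ∑ u, (failCount (fun v : Fin (m * k) → Bool => win (Fin.append v u)) : ℤ) := by
    calc ((failCount K0 ^ (k + 1) : ℕ) : ℤ) = (failCount K0 : ℤ) * ((failCount K0 ^ k : ℕ) : ℤ) := by
          push_cast; ring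
      _ ≤ (failCount K0 : ℤ) * (distTo S (fun _ => true) : ℤ) :=
          mul_le_mul_of_nonneg_left hW' (by positivity)
      _ ≤ _ := hfinal
  exact_mod_cast h1

/-- Base of the induction (`k = 0`): the empty sum code forces `win ≡ 0`, one failure. -/
theorem base {m : ℕ} {K0 : (Fin m → Bool) → Bool} (win : (Fin (m * 0) → Bool) → Bool)
    (hwin : SumCodeWin (m * 0) 0 1 win) : failCount K0 ^ 0 ≤ failCount win := by
  have hall : ∀ u, win u = false := eq_false_of_sumCodeWin_zero hwin
  have h1 : failCount win = 1 := by
    unfold failCount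
    rw [filter_true_of_mem fun u _ => hall u, card_univ, Fintype.card_fun, Fintype.card_bool,
      Fintype.card_fin]
    simp
  rw [h1, pow_zero]

/-- **Every level**: `|Z|^k ≤ #FAIL(win)` for every element of the `k`-block sum-code coset of `𝟙`. -/
theorem pow_le_failCount {m : ℕ} {K0 : (Fin m → Bool) → Bool} (hK : IsOpt1 m K0)
    (hMI : ∀ k, 0 < k → MassIneqK m k K0) :
    ∀ (k : ℕ) (win : (Fin (m * k) → Bool) → Bool), SumCodeWin (m * k) k 1 win →
      failCount K0 ^ k ≤ failCount win
  | 0 => fun win hwin => base win hwin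
  | k + 1 => fun win hwin => by
      have hMIk : MassIneqK m k K0 := by
        rcases Nat.eq_zero_or_pos k with hk | hk
        · subst hk; exact massIneqK_zero hK
        · exact hMI k hk
      exact step hK.1 hMIk (pow_le_failCount hK hMI k) win hwin

end MIPays

open MIPays

/-- **The recursion**: MI at all levels at an optimal `K0` pays `TensorMultAt m 1 (failCount K0 / 2^m)`. -/
theorem tensorMultAt_of_massIneq {m : ℕ} {K0 : (Fin m → Bool) → Bool} (hK : IsOpt1 m K0)
    (hMI : ∀ k, 0 < k → MassIneqK m k K0) :
    TensorMultAt m 1 ((failCount K0 : ℝ) / (2 : ℝ) ^ m) := by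
  intro k _ win hwin
  have h2 : (2 : ℝ) ^ m ≠ 0 := pow_ne_zero _ two_ne_zero
  rw [div_mul_cancel₀ _ h2]
  exact_mod_cast pow_le_failCount hK hMI k win hwin

/-- **`MassIneqKPays m` for every `m` — PROVED** (planner qa-qnc0-p1 Sketch13 v6b, ask P18″). -/
theorem massIneqKPays (m : ℕ) : MassIneqKPays m :=
  fun _ hK hMI => tensorMultAt_of_massIneq hK hMI

/-- **`ExactMultSeven` — PROVED**: `TensorMultAt 7 1 (16/2^7)`, i.e. `W_k(7,1) ≥ 16^k` for every `k`
(from the kernel-checked LP certificate `tensorMultAt_seven`; `16/2^7 = 1/8`). -/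
theorem exactMultSeven : ExactMultSeven := by
  unfold ExactMultSeven
  have h : ((16 : ℝ) / (2 : ℝ) ^ 7) = 1 / 8 := by norm_num
  rw [h]
  exact tensorMultAt_seven

/-- With `massIneqKPays` and `domPays` in hand, `DomSeven` alone also gives `ExactMultSeven`
(the planner's LP-free route `exactMultSeven_of`). -/
theorem exactMultSeven_of_domSeven (h : DomSeven) : ExactMultSeven :=
  exactMultSeven_of h (domPays 7) (massIneqKPays 7)

/-- **MI pays MULT₁** (the planner's `MIChainFifteen` with its `MassIneqKPays` hypothesis discharged, at
any block size): an optimal symmetric codeword failing on more than a quarter of the cube plus the mass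
inequality at every level gives `TensorMultOneAt`. -/
theorem tensorMultOneAt_of_massIneqAll {m : ℕ}
    (hex : ∃ K0 : (Fin m → Bool) → Bool, IsOpt1 m K0 ∧ IsSymPat K0 ∧ 2 ^ m < 4 * failCount K0)
    (hMI : MassIneqAll m) : TensorMultOneAt := by
  obtain ⟨K0, hopt, hsym, hbig⟩ := hex
  refine ⟨m, (failCount K0 : ℝ) / (2 : ℝ) ^ m, ?_, tensorMultAt_of_massIneq hopt (hMI K0 hopt hsym)⟩
  have h2 : (0 : ℝ) < (2 : ℝ) ^ m := pow_pos two_pos m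
  rw [lt_div_iff₀ h2]
  have hb : ((2 ^ m : ℕ) : ℝ) < ((4 * failCount K0 : ℕ) : ℝ) := by exact_mod_cast hbig
  push_cast at hb
  linarith

/-- `MIChainFifteen` with the recursion discharged: at `m = 15` only the existence conjunct and
`MassIneqAll 15` remain. -/
theorem tensorMultOneAt_of_massIneqAll_fifteen
    (hex : ∃ K0 : (Fin 15 → Bool) → Bool, IsOpt1 15 K0 ∧ IsSymPat K0 ∧ 2 ^ 15 < 4 * failCount K0)
    (hMI : MassIneqAll 15) : TensorMultOneAt :=
  tensorMultOneAt_of_massIneqAll hex hMI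

end Summit.QuantumAdvantage.AdviceFreeQNC0
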